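import Summits.QuantumFields.YangMills.Theorems.AlphaInputsT3ACv3Prop1Blocks
import HarnessLib

/-!
# `AlphaInputsT3ACv3RegionProp2` — [Balaban1985Averaging] PROPOSITION 2 (52)–(54) FOR THE (0.4) AVERAGING OF RECORD ON A **REGION** (a union
# of level-`k` blocks), UNIFORMLY IN THE NUMBER OF AVERAGINGS: fine regularity UNDER the region gives the regularity of every `j`-fold average at
# the plaquettes of the region — lane `pub-balaban3d`, seat alpha-2 (g4)

WHY (HOME `pub-balaban3d` STATUS, alpha-2 g4).  Row r3 of the adapted class `𝒞_R(k,h,W)` (`AlphaInputsT3AC.reg68LevelsSet`) asks the `s`-fold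
`blockAvg ℰp`-averages of the witness to be regular at the level-`s` plaquettes INSIDE `Ω_k(h)` (and inside the `Λ_i(h)`); the witness is glued from
a lift regular UNDER `Ω_k(h)` only.  The tree's Prop. 2 for (0.4) (`BlockAveragingEMLProp2.plaqSmall_iter_blockAvg_eml_level`) is GLOBAL (`PlaqSmall`
on the whole torus).  THIS FILE: ★★ `dist1_iter_blockAvg_lt_region` — for a nested family of coarse-site sets `R i ⊂ T^{(i)}` (`z ∈ R i ↔
blockOf z ∈ R (i+1)`: the level-`i` sites UNDER a set of level-`k` blocks), if every FINE plaquette with its four corners in `R 0` is within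
`α₀·L^{−2k}` of `1` (`C₀(d)α₀ ≤ ⅓`, `2α₀ ≤ c′₂`), then for every `j ≤ k` every level-`j` plaquette with its four corners in `R j` has its `j`-fold
average within `2α₀·(L^j/L^k)²` of `1` — the printed (53) induction (`B7.ineq53_induction`) run on the region with the sibling's Prop. 1 of printed
locality (`…v3Prop1Blocks.dist1_plaqHol_avgFun_le_sharp_of_region`): the fine plaquettes feeding a coarse plaquette of the region lie in the four
blocks under its corners, i.e. in the region one level down.  §1 the region-restricted level suprema; §2 the induction; §3 the form read by r3
(`plaqsIn`-style corner sets are the consumer's bookkeeping).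
HONEST FRAMING.  Nothing of [Balaban1985Averaging] is asserted; kernel theorems over the tree's own (0.4) objects; count-neutral helper toward R3 2′
(`stub_laneRecordsV3`, items 19935∕19936); registry untouched; nothing about d = 4, the continuum, or a mass gap.

References: T. Bałaban, Commun. Math. Phys. 98 (1985) 17–51 [Balaban1985Averaging] (Prop. 1 (51), Prop. 2 (52)–(54) p.26); CMP 109 (1987) 249–301
[Balaban1987RG1] ((0.3)–(0.4) pp.252–253).
-/

set_option autoImplicit false

namespace Summit.QuantumFields.YangMills.Theorems.BoxStokes

open Literature.MathematicalPhysics.QuantumFieldTheory.Balaban1983to89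
open T4Continuum T4ReflectionCone BlockAveraging AveragingRT ExpMeanLog BlockAveragingEMLProp2

variable {P : Params} {n : Type*} [Fintype n] [DecidableEq n] [Nonempty n]

/-! ## §1 Level suprema restricted to a family of plaquette predicates -/

section LevelSup

/-- The level suprema of `|V_i(∂p) − 1|` over the plaquettes SELECTED at each level (achieved maxima over finite sets; `0` when nothing is selected):
every selected plaquette is below `a_i`, and `a_i` is below any strict uniform bound on the selected plaquettes. [cite: Balaban1985Averaging, (53) p.26] -/
theorem exists_levelSup_on (V : (i : ℕ) → GaugeField P i (Matrix.specialUnitaryGroup n ℂ)) (S : (i : ℕ) → Plaq P i → Prop) :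
    ∃ a : ℕ → ℝ, (∀ i, 0 ≤ a i) ∧ (∀ i (p : Plaq P i), S i p → dist1 (GaugeField.plaqHol (V i) p) ≤ a i) ∧
      ∀ i (B : ℝ), 0 < B → (∀ p : Plaq P i, S i p → dist1 (GaugeField.plaqHol (V i) p) < B) → a i < B := by
  classical
  let T : (i : ℕ) → Finset (Plaq P i) := fun i => Finset.univ.filter fun p => S i p
  refine ⟨fun i => if h : (T i).Nonempty then (T i).sup' h (fun p => dist1 (GaugeField.plaqHol (V i) p)) else 0,
    fun i => ?_, fun i p hp => ?_, fun i B hB h => ?_⟩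
  · dsimp only
    by_cases hne : (T i).Nonempty
    · rw [dif_pos hne]
      obtain ⟨q₀, -, hq₀⟩ := Finset.exists_mem_eq_sup' hne fun p => dist1 (GaugeField.plaqHol (V i) p)
      rw [hq₀]; exact GaugeGroup.dist1_nonneg _
    · rw [dif_neg hne]
  · dsimp only
    have hmem : p ∈ T i := by simp [T, hp]
    have hne : (T i).Nonempty := ⟨p, hmem⟩
    rw [dif_pos hne]
    exact Finset.le_sup' (fun p => dist1 (GaugeField.plaqHol (V i) p)) hmem
  · dsimp only
    by_cases hne : (T i).Nonempty
    · rw [dif_pos hne]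
      obtain ⟨q₀, hq₀, hq₀'⟩ := Finset.exists_mem_eq_sup' hne fun p => dist1 (GaugeField.plaqHol (V i) p)
      rw [hq₀']
      exact h q₀ (by simpa [T] using hq₀)
    · rw [dif_neg hne]; exact hB

end LevelSup

/-! ## §2 Prop. 2 on a region, uniformly in the number of averagings -/

section Region

/-- The second-order constant in the two currencies: `143·((((d+4)L)²/4)·a)² = C₀(d)·(L²a)²`. [folklore] -/
private theorem secondOrder_eq' (a : ℝ) :
    143 * (((((P.d + 4) * P.L : ℕ) : ℝ) ^ 2 / 4) * a) ^ 2 =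
      (143 * ((((P.d + 4 : ℕ) : ℝ)) ^ 2 / 4) ^ 2) * ((P.L : ℝ) ^ 2 * a) ^ 2 := by
  push_cast; ring

/-- **★★ [Balaban1985Averaging] PROP. 2 (52)–(53) FOR (0.4) ON A REGION, UNIFORMLY IN THE NUMBER OF AVERAGINGS.**  Let `R i ⊂ T^{(i)}` (`i ≤ k`)
be NESTED coarse-site sets, `z ∈ R i ↔ blockOf z ∈ R (i+1)` for `i < k` (the sites under a union of level-`k` blocks), `k ≤ m + K`.  If every fine
plaquette with its four corners in `R 0` is within `α₀·L^{−2k}` of `1`, with `C₀(d)α₀ ≤ ⅓` and `2α₀ ≤ c′₂ = 2δ_N/((d+4)L)²`, then for every `j ≤ k`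
every plaquette of `T^{(j)}` with its four corners in `R j` has `|Ū^j(∂p) − 1| < 2α₀·(L^j·L^{−k})²`.  (The tree's global theorem is the case
`R i = univ`.) [cite: Balaban1985Averaging, Prop. 2 (52)–(54) p.26] -/
theorem dist1_iter_blockAvg_lt_region (k : ℕ) (hk : k ≤ P.m + P.K) {α₀ : ℝ} (hα : 0 < α₀)
    (hα3 : (143 * ((((P.d + 4 : ℕ) : ℝ)) ^ 2 / 4) ^ 2) * α₀ ≤ 1 / 3)
    (hα2 : 2 * α₀ ≤ 2 * deltaSU n / (((P.d + 4) * P.L : ℕ) : ℝ) ^ 2)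
    (R : (i : ℕ) → Set (Site P i)) (hR : ∀ i, i < k → ∀ z : Site P i, z ∈ R i ↔ blockOf z ∈ R (i + 1))
    {U : GaugeField P 0 (Matrix.specialUnitaryGroup n ℂ)}
    (h52 : ∀ q : Plaq P 0, q.src ∈ R 0 → q.src.shift q.μ ∈ R 0 → q.src.shift q.ν ∈ R 0 → (q.src.shift q.μ).shift q.ν ∈ R 0 →
      dist1 (GaugeField.plaqHol U q) < α₀ * (((P.L : ℝ) ^ k)⁻¹) ^ 2)
    {j : ℕ} (hj : j ≤ k) (p : Plaq P j) (h1 : p.src ∈ R j) (h2 : p.src.shift p.μ ∈ R j) (h3 : p.src.shift p.ν ∈ R j)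
    (h4 : (p.src.shift p.μ).shift p.ν ∈ R j) :
    dist1 (GaugeField.plaqHol (Averaging.iter (fun _ => blockAvg (expMeanLogSU (n := n))) j U) p) <
      2 * α₀ * ((P.L : ℝ) ^ j * ((P.L : ℝ) ^ k)⁻¹) ^ 2 := by
  obtain ⟨a, ha0, hale, halt⟩ := exists_levelSup_on (fun i => Averaging.iter (fun _ => blockAvg (expMeanLogSU (n := n))) i U)
    (fun i q => q.src ∈ R i ∧ q.src.shift q.μ ∈ R i ∧ q.src.shift q.ν ∈ R i ∧ (q.src.shift q.μ).shift q.ν ∈ R i)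
  have hL : (2 : ℝ) ≤ P.L := by exact_mod_cast P.hL.2
  have hLpos : (0 : ℝ) < (P.L : ℝ) ^ k := by have := P.L_pos; positivity
  have hC₀ : (0 : ℝ) < 143 * ((((P.d + 4 : ℕ) : ℝ)) ^ 2 / 4) ^ 2 := by positivity
  have hind := B7.ineq53_induction (P.L : ℝ) (((P.L : ℝ) ^ k)⁻¹) α₀ (143 * ((((P.d + 4 : ℕ) : ℝ)) ^ 2 / 4) ^ 2)
    (2 * deltaSU n / (((P.d + 4) * P.L : ℕ) : ℝ) ^ 2) k a hL (inv_pos.mpr hLpos) (mul_inv_cancel₀ hLpos.ne').le hC₀ hα hα3 hα2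
    (halt 0 _ (by positivity) fun q hq => h52 q hq.1 hq.2.1 hq.2.2.1 hq.2.2.2) ?_ j hj
  · refine (hale j p ⟨h1, h2, h3, h4⟩).trans_lt (hind.trans_le ?_)
    set x : ℝ := ((P.L : ℝ) ^ j * ((P.L : ℝ) ^ k)⁻¹) ^ 2 with hx
    have hx0 : 0 ≤ x := by positivity
    have hx1 : x ≤ 1 := by
      rw [hx]
      have hjk : (P.L : ℝ) ^ j * ((P.L : ℝ) ^ k)⁻¹ ≤ 1 := by
        rw [mul_inv_le_iff₀ hLpos, one_mul]
        exact pow_le_pow_right₀ (by linarith) hj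
      have h0 : 0 ≤ (P.L : ℝ) ^ j * ((P.L : ℝ) ^ k)⁻¹ := by positivity
      nlinarith
    have hS := B7.geom_bracket_le_two _ (by positivity) (B7.prop2_ratio_lt_half _ α₀ (P.L : ℝ) hL (by positivity) hα3).le j
    have hCa : 0 ≤ 143 * ((((P.d + 4 : ℕ) : ℝ)) ^ 2 / 4) ^ 2 * (α₀ * x) ^ 2 := by positivity
    calc α₀ * x + 143 * ((((P.d + 4 : ℕ) : ℝ)) ^ 2 / 4) ^ 2 * (α₀ * x) ^ 2 *
          ∑ i ∈ Finset.range j, ((1 + 143 * ((((P.d + 4 : ℕ) : ℝ)) ^ 2 / 4) ^ 2 * α₀) ^ 2 / (P.L : ℝ) ^ 2) ^ i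
        ≤ α₀ * x + 143 * ((((P.d + 4 : ℕ) : ℝ)) ^ 2 / 4) ^ 2 * (α₀ * x) ^ 2 * 2 := by gcongr
      _ ≤ 2 * α₀ * x := by
          have hx2 : x * x ≤ x := by nlinarith
          have hαx : 0 ≤ α₀ * x := mul_nonneg hα.le hx0
          have e1 : (α₀ * x) ^ 2 ≤ (α₀ * x) * α₀ := by
            rw [show (α₀ * x) ^ 2 = α₀ * α₀ * (x * x) by ring, show α₀ * x * α₀ = α₀ * α₀ * x by ring]
            exact mul_le_mul_of_nonneg_left hx2 (by positivity)
          have e2 : 143 * ((((P.d + 4 : ℕ) : ℝ)) ^ 2 / 4) ^ 2 * (α₀ * x) ^ 2 * 2 ≤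
              143 * ((((P.d + 4 : ℕ) : ℝ)) ^ 2 / 4) ^ 2 * ((α₀ * x) * α₀) * 2 := by gcongr
          have e3 : 143 * ((((P.d + 4 : ℕ) : ℝ)) ^ 2 / 4) ^ 2 * ((α₀ * x) * α₀) * 2 =
              (143 * ((((P.d + 4 : ℕ) : ℝ)) ^ 2 / 4) ^ 2 * α₀) * (α₀ * x) * 2 := by ring
          rw [e3] at e2
          have e4 : (143 * ((((P.d + 4 : ℕ) : ℝ)) ^ 2 / 4) ^ 2 * α₀) * (α₀ * x) * 2 ≤ (1 / 3) * (α₀ * x) * 2 := by gcongr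
          linarith
  -- the (53) step on the region: Prop. 1 of printed locality at level `i + 1` from the region's level-`i` plaquettes
  intro i hi Q hQ hQc hai
  have hsm : ((((P.d + 4) * P.L : ℕ) : ℝ) ^ 2 / 4) * a i ≤ deltaSU n / 2 :=
    (mul_le_mul_of_nonneg_left (hai.le.trans hQc) (by positivity)).trans (smallness_of_le_c2' le_rfl)
  have hi' : i + 1 ≤ P.m + P.K := by omega
  refine halt (i + 1) _ (by positivity) fun p hp => ?_
  obtain ⟨hp1, hp2, hp3, hp4⟩ := hp
  have h1 := dist1_plaqHol_avgFun_le_sharp_of_region hi' (ha0 i) hsm (R (i + 1))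
    (fun q hq1 hq2 hq3 hq4 => hale i q ⟨(hR i hi _).2 hq1, (hR i hi _).2 hq2, (hR i hi _).2 hq3, (hR i hi _).2 hq4⟩) p hp1 hp2 hp3 hp4
  rw [secondOrder_eq'] at h1
  refine (show dist1 (GaugeField.plaqHol (Averaging.iter (fun _ => blockAvg (expMeanLogSU (n := n))) (i + 1) U) p) ≤ _ from h1).trans_lt ?_
  have hL2 : (0 : ℝ) < (P.L : ℝ) ^ 2 := by have := P.L_pos; positivity
  have e1 : (P.L : ℝ) ^ 2 * a i < (P.L : ℝ) ^ 2 * Q := mul_lt_mul_of_pos_left hai hL2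
  have e2 : ((P.L : ℝ) ^ 2 * a i) ^ 2 ≤ ((P.L : ℝ) ^ 2 * Q) ^ 2 := by
    have := ha0 i
    gcongr
  nlinarith [mul_le_mul_of_nonneg_left e2 hC₀.le]

end Region

end Summit.QuantumFields.YangMills.Theorems.BoxStokes
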